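import Summits.QuantumFields.YangMills.Theorems.FluctuationComparisonRegPrIntLS2BetaDescentLipschitz
import Summits.QuantumFields.YangMills.Theorems.FluctuationComparisonRegPrIntLSupTailDepthInduction
import Summits.QuantumFields.YangMills.Theorems.FluctuationComparisonRegPrIntLOrganTangentTopDisplacementLipOfHdisp
import Summits.QuantumFields.YangMills.Theorems.FluctuationComparisonRegPrIntLOrganTangentJunctionDirectTransportCore
import HarnessLib

/-!
# Crux `FluctuationComparisonRegPrIntL` (stmt-QuantumFields-20520, rung R3), PATH-B organ — «THE MULTI-LEVEL PLAQUETTE-DISPLACEMENT MODULUS FROM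
# BONDWISE INCREMENTS AND THE MULTI-WINDOW» ((B′) of the (I-law) REG′ reduction, `ym-ust-20520-w5` g25 (L44b); D0 lineage `ym3-torus-px19` g22; DEFINITION-FREE):
# along a fine curve whose open-interior points lie in the multi-window good set, the level-`n` descended plaquette variables are Lipschitz in the curve
# parameter with modulus `4·(150L)^{Ts−n}·√3·K`, from the curve's bondwise exponential increments ALONE — so the letter «`hdisp_n`, j < n < Ts» DISSOLVES

Cell `ym3-torus` (YM ladder rung R3 = continuum `SU(2)` Yang–Mills on the three-torus — a RUNG: NOT d = 4, NOT infinite volume, NOT a mass gap, NOT Clay).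
Width seat `ym3-torus-px19` (gen 22; pen named by w5 g25 12:51:27Z «PEN (B′) = YOURS»); `--kind proof --supports stmt-QuantumFields-20520 --as helper`,
count-neutral, no registry ∕ binder ∕ `Lines/` edit, default heartbeats, `autoImplicit false`.

WHAT.  §1 ★`norm_coe_mul_expPt_sub_le` — a bondwise exponential increment `U e = W e·expPt w` moves the link matrix by `‖↑(U e) − ↑(W e)‖ ≤ √3·‖w‖`
(✓`dist1_mul_inv_eq_norm_sub` + conjugation invariance + ✓`dist1_expPt_le_sqrt3_mul_norm`).  §2 ★★`abs_dist1_descendTo_sub_le_of_multiwindow` — AT A MULTI-WINDOW BASE: if every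
descended level `n′ ∈ (j, Ts]` of `W` is in its `24∕25·θ_{n′}`-window (the cut's support condition), `θ_{n′} ≤ θmax` there, `U` is bondwise `ρ`-close to `W`
in matrix norm and `stokesConst·(24∕25·θmax + 4·(30ℓ)^{Ts−n}·ρ) ≤ 1∕24` (`ℓ = 5L`), then for every level `n ∈ (j, Ts]` and level-`n` plaquette `p`,
`|dist1 ((D_{n,Ts}U)(∂p)) − dist1 ((D_{n,Ts}W)(∂p))| ≤ 4·(30ℓ)^{Ts−n}·ρ` — px13 g20's ✓`norm_descendTo_sub_descendTo_le_of_iterSmall` ([Balaban1987RG1] (0.4)∕(0.11):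
the iterated one-step averages are sup-Lipschitz at a base whose ITERATES are small — NOT ξ²-regularity) with `hsmall` = the multi-window read through
✓`plaqSmall_descendTo_iff`, then ✓`plaqDev_le_four_mul` ∘ ✓`abs_dist1_plaqHol_sub_le`.  §3 ★★★`lipschitzOnWith_dist1_descendTo_of_incr` — ALONG A FINE CURVE
`c : ℝ → G_Ts` on `I := Ioo (−1) 2 ∩ uIcc x y`: multi-window on the OPEN interior `uIoo x y`, bondwise exponential increments `c s′ e = c s e·expPt w`,
`‖w‖ ≤ k e·|s − s′|` for pairs of `I` at distance `≤ δ`, `0 ≤ k`, `Σ k ≤ K`, and the smallness row ⟹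
`LipschitzOnWith (toNNReal (4·(30ℓ)^{Ts−n}·(√3·K))) (s ↦ dist1 ((D_{n,Ts}(c s))(∂p))) I` (midpoint base in the open interior + §2 twice, then local-to-global
✓`lipschitzOnWith_of_local`).  §4 ★★★`pdispLip_of_incr` ∕ `sdispLip_of_incr` — THE ORGAN READINGS: (L44b) ✓`weightLip_of_beta_of_goodSetLetters`'s letters
(Φ-disp-Lip∣MW) along near relational PATHS (`hPdisp`) and square `s`-EDGES (`hSdisp`), CHARACTER-EXACT, FROM its own increment letters (Φ-bond-incr-loc∣MW)
(`hPincr` ∕ `hSincr`, CHARACTER-EXACT) + `θ_{n′} ≤ θmax` on `(j, Ts]` + ONE smallness row `stokesConst·(24∕25·θmax + 4·(30ℓ)^{Ts−(j+1)}·(√3·K·δ)) ≤ 1∕24`,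
with the level-uniform modulus `D := toNNReal (4·(30ℓ)^{Ts−(j+1)}·(√3·K))`.

WHY (px19 g22 12:46:01Z, located): the other tree route ✓`exists_supLipschitz_of_plaqSmall` wants the base `PlaqSmall (regThreshold F n Ts e) = e·L^{−2(Ts−n)}`-regular
— print's ξ²-regularity of MINIMISERS ([Balaban1985Variational] (2), Thm 1 (8)–(10)) —, which the multi-window (`θ_Ts = √γ·p·L^{−Ts∕2}`) does not give at deep
strides for a generic fibre point; §1 of the same file needs only the ITERATES small, which IS the multi-window.  Consequence for the (I-law) REG′ debt after
(L38)–(L44): its chart letters are {(Φ-bond-incr-loc∣MW) = `Dlink`, (J-Lip∣MW)} ONLY — `hdisp_n` is not a letter.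

HONEST FRAMING: sup-norm kinematics of the tree's own block average + window bookkeeping over HYPOTHESIS letters (the increments, the multi-window antecedent);
nothing constructs Bałaban's chart; nothing of Bałaban's analysis is asserted or proved; (I-law) REG′∕KER′, (I-curv), (I-cov), rows `OrganDischargeInputsHJ(sq)`,
`SpreadFibreLawH(J)(sq)`, O1ᵘ-H, S1aᴴ, S2β, the five registered stubs, crux 20520 and `YM3TorusSU2` are NOT proved; registry `Lines/semiclassical_s2beta.lean`
untouched; rung R3 = SU(2) YM₃ on T³ at fixed lattice data — NOT d = 4, NOT infinite volume, NOT a mass gap, NOT Clay; the Yang–Mills mass gap is NOT proved.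
[folklore; cite: Balaban1987RG1, (0.4) and (0.11) p.253; Balaban1985Averaging, Prop. 1 p.26]
-/

set_option autoImplicit false

noncomputable section

namespace Summit.QuantumFields.YangMills.Theorems.OrganTangentMultiLevelDispLipOfIncr

open Set Function
open scoped NNReal BigOperators Matrix.Norms.L2Operator
open Literature.MathematicalPhysics.QuantumFieldTheory.Balaban1983to89 T3ContinuumYM3Torus T3NestedUnitLaws T3UnitLawDensityEML T4Continuum BalabanUVClass
  T3UnitScaleTilt T3LevelShift T3TiltDescent
open T4CubeChartExp (expPt)
open T4TiltOscillation (bdev)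
open T4ExpWindowSmallField (abs_dist1_plaqHol_sub_le plaqDev_le_four_mul)
open Summit.QuantumFields.YangMills.Theorems.FluctuationComparisonRegPrIntLS2BetaSignedCombLipschitz (dist1_mul_inv_eq_norm_sub)
open Summit.QuantumFields.YangMills.Theorems.BlockAvgCorrector (stokesConst stokesConst_nonneg)
open Summit.QuantumFields.YangMills.Theorems.FluctuationComparisonRegPrIntLS2BetaDescentLipschitz (norm_descendTo_sub_descendTo_le_of_iterSmall)
open Summit.QuantumFields.YangMills.Theorems.FluctuationComparisonRegPrIntLSupTailDepthInduction (plaqSmall_descendTo_iff)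
open Summit.QuantumFields.YangMills.Theorems.OrganTangentTopDisplacementLipOfHdisp (lipschitzOnWith_of_local)
open Summit.QuantumFields.YangMills.Theorems.OrganTangentJunctionDirectTransportCore (dist1_expPt_le_sqrt3_mul_norm)
open Summit.QuantumFields.YangMills.Theorems.OrganTangentILawKnitFacts (plaqSmall_mono)

variable (F : T3Family)

/-! ## §1 A bondwise exponential increment moves the link matrix by `√3·‖w‖` -/

/-- `‖↑(W·expPt w) − ↑W‖ = dist1 (expPt w) ≤ √3·‖w‖` in `SU(2)` (L²-operator norm of the underlying matrices). [folklore] -/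
theorem norm_coe_mul_expPt_sub_le (W : Matrix.specialUnitaryGroup (Fin 2) ℂ) (w : Fin 3 → ℝ) :
    ‖((W * expPt w : Matrix.specialUnitaryGroup (Fin 2) ℂ) : Matrix (Fin 2) (Fin 2) ℂ) - (W : Matrix (Fin 2) (Fin 2) ℂ)‖ ≤ Real.sqrt 3 * ‖w‖ := by
  rw [← dist1_mul_inv_eq_norm_sub (W * expPt w) W, GaugeGroup.dist1_conj (expPt w) W]
  exact dist1_expPt_le_sqrt3_mul_norm w

/-- Bondwise form: `U e = W e·expPt (w e)` with `√3·‖w e‖ ≤ ρ` for every fine bond ⟹ `‖↑(U e) − ↑(W e)‖ ≤ ρ`. [folklore] -/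
theorem norm_coe_sub_le_of_incr {P : Params} {i : ℕ} (W U : GaugeField P i ↥(Matrix.specialUnitaryGroup (Fin 2) ℂ)) {ρ : ℝ}
    (hincr : ∀ e, ∃ w : Fin 3 → ℝ, U e = W e * expPt w ∧ Real.sqrt 3 * ‖w‖ ≤ ρ) (e : PBond P i) :
    ‖((U e : Matrix.specialUnitaryGroup (Fin 2) ℂ) : Matrix (Fin 2) (Fin 2) ℂ) - (W e : Matrix (Fin 2) (Fin 2) ℂ)‖ ≤ ρ := by
  obtain ⟨w, hw, hρ⟩ := hincr e
  rw [hw]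
  exact (norm_coe_mul_expPt_sub_le (W e) w).trans hρ

/-! ## §2 At a multi-window base: the descended plaquette variables move by `4·(30ℓ)^{Ts−n}·ρ` -/

/-- ★★ **AT A MULTI-WINDOW BASE.**  `W` with every descended level `n′ ∈ (j, Ts]` in its `24∕25·θ_{n′}`-window, `θ_{n′} ≤ θmax` there; `U` bondwise `ρ`-close to `W`
in matrix norm; `stokesConst·(24∕25·θmax + 4·(30ℓ)^{Ts−n}·ρ) ≤ 1∕24` ⟹ for every `n ∈ (j, Ts]` and level-`n` plaquette `p`,
`|dist1 ((D_{n,Ts}U)(∂p)) − dist1 ((D_{n,Ts}W)(∂p))| ≤ 4·(30ℓ)^{Ts−n}·ρ` (`ℓ = 5L`).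
[cite: Balaban1987RG1, (0.4) and (0.11) p.253; Balaban1985Averaging, Prop. 1 p.26] -/
theorem abs_dist1_descendTo_sub_le_of_multiwindow {γ b₀ p₀ : ℝ} {j Ts n : ℕ} (hjn : j + 1 ≤ n) (hnT : n ≤ Ts)
    (W U : GaugeField (F.P Ts) 0 ↥(Matrix.specialUnitaryGroup (Fin 2) ℂ)) {θmax ρ : ℝ} (hθmax0 : 0 ≤ θmax) (hρ : 0 ≤ ρ)
    (hMW : ∀ (n' : ℕ) (hjn' : j + 1 ≤ n') (hn'T : n' ≤ Ts), PlaqSmall (24 / 25 * θBal F.L γ b₀ p₀ n') (descendTo F ℰp n' Ts hn'T W))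
    (hθle : ∀ n', j + 1 ≤ n' → n' ≤ Ts → θBal F.L γ b₀ p₀ n' ≤ θmax)
    (hclose : ∀ e : PBond (F.P Ts) 0,
      ‖((U e : Matrix.specialUnitaryGroup (Fin 2) ℂ) : Matrix (Fin 2) (Fin 2) ℂ) - (W e : Matrix (Fin 2) (Fin 2) ℂ)‖ ≤ ρ)
    (h24 : stokesConst (F.P Ts) * (24 / 25 * θmax + 4 * ((30 * (((3 + 2) * F.L : ℕ) : ℝ)) ^ (Ts - n) * ρ)) ≤ 1 / 24)
    (p : Plaq (F.P n) 0) :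
    |dist1 (GaugeField.plaqHol (descendTo F ℰp n Ts hnT U) p) - dist1 (GaugeField.plaqHol (descendTo F ℰp n Ts hnT W) p)| ≤
      4 * ((30 * (((3 + 2) * F.L : ℕ) : ℝ)) ^ (Ts - n) * ρ) := by
  -- the iterates of the base are small: the multi-window read through `descendTo = fieldShift ∘ iter`
  have hsmall : ∀ i, i < Ts - n →
      PlaqSmall (24 / 25 * θmax)
        (Averaging.iter (fun i => BlockAveraging.blockAvg (P := F.P Ts) (j := i) (ExpMeanLog.expMeanLogSU (n := Fin 2))) i W) := by
    intro i hi
    have hle : Ts - i ≤ Ts := Nat.sub_le _ _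
    have h1 := hMW (Ts - i) (by omega) hle
    rw [plaqSmall_descendTo_iff] at h1
    rw [show Ts - (Ts - i) = i by omega] at h1
    exact plaqSmall_mono (by nlinarith [hθle (Ts - i) (by omega) hle]) h1
  have hD := norm_descendTo_sub_descendTo_le_of_iterSmall F hnT (by positivity) hρ W U hsmall hclose h24
  -- bond deviations of the two descended fields
  have hb : ∀ b : PBond (F.P n) 0, dist1 (bdev (descendTo F ℰp n Ts hnT U) (descendTo F ℰp n Ts hnT W) b) ≤
      (30 * (((3 + 2) * F.L : ℕ) : ℝ)) ^ (Ts - n) * ρ := by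
    intro b
    show dist1 ((descendTo F ℰp n Ts hnT W b)⁻¹ * descendTo F ℰp n Ts hnT U b) ≤ _
    rw [B11GaugeGlue.dist1_inv_mul_eq, dist1_mul_inv_eq_norm_sub, norm_sub_rev]
    exact hD b
  exact (abs_dist1_plaqHol_sub_le _ _ p).trans (plaqDev_le_four_mul hb p)

/-! ## §3 Along a fine curve: Lipschitz on a good-interior segment from bondwise increments -/

/-- ★★★ **THE MULTI-LEVEL DISPLACEMENT MODULUS FROM INCREMENTS.**  A fine curve `c` on `I := Ioo (−1) 2 ∩ uIcc x y` whose OPEN-interior points `r ∈ uIoo x y`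
are in the multi-window, with bondwise exponential increments `c s′ e = c s e·expPt w`, `‖w‖ ≤ k e·|s − s′|` for pairs of `I` at distance `≤ δ` (`0 ≤ k`,
`Σ k ≤ K`), `θ_{n′} ≤ θmax` on `(j, Ts]` and `stokesConst·(24∕25·θmax + 4·(30ℓ)^{Ts−n}·(√3·K·δ)) ≤ 1∕24` ⟹ for every level-`n` plaquette `p`,
`s ↦ dist1 ((D_{n,Ts}(c s))(∂p))` is Lipschitz on `I` with modulus `4·(30ℓ)^{Ts−n}·(√3·K)`. [folklore] -/
theorem lipschitzOnWith_dist1_descendTo_of_incr {γ b₀ p₀ : ℝ} {j Ts n : ℕ} (hjn : j + 1 ≤ n) (hnT : n ≤ Ts)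
    (c : ℝ → GaugeField (F.P Ts) 0 ↥(Matrix.specialUnitaryGroup (Fin 2) ℂ)) {x y : ℝ}
    (hMW : ∀ r ∈ Set.uIoo x y, ∀ (n' : ℕ) (hjn' : j + 1 ≤ n') (hn'T : n' ≤ Ts),
      PlaqSmall (24 / 25 * θBal F.L γ b₀ p₀ n') (descendTo F ℰp n' Ts hn'T (c r)))
    {θmax δ K : ℝ} (hθmax0 : 0 ≤ θmax) (hθle : ∀ n', j + 1 ≤ n' → n' ≤ Ts → θBal F.L γ b₀ p₀ n' ≤ θmax) (hδ : 0 < δ)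
    (k : PBond (F.P Ts) 0 → ℝ) (hk0 : ∀ e, 0 ≤ k e) (hK : ∑ e, k e ≤ K)
    (hincr : ∀ s ∈ Set.Ioo (-1 : ℝ) 2 ∩ Set.uIcc x y, ∀ s' ∈ Set.Ioo (-1 : ℝ) 2 ∩ Set.uIcc x y, |s - s'| ≤ δ →
      ∀ e, ∃ w : Fin 3 → ℝ, c s' e = c s e * expPt w ∧ ‖w‖ ≤ k e * |s - s'|)
    (h24 : stokesConst (F.P Ts) * (24 / 25 * θmax + 4 * ((30 * (((3 + 2) * F.L : ℕ) : ℝ)) ^ (Ts - n) * (Real.sqrt 3 * K * δ))) ≤ 1 / 24)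
    (p : Plaq (F.P n) 0) :
    LipschitzOnWith (Real.toNNReal (4 * (30 * (((3 + 2) * F.L : ℕ) : ℝ)) ^ (Ts - n) * (Real.sqrt 3 * K)))
      (fun s => dist1 (GaugeField.plaqHol (descendTo F ℰp n Ts hnT (c s)) p)) (Set.Ioo (-1 : ℝ) 2 ∩ Set.uIcc x y) := by
  set A : ℝ := (30 * (((3 + 2) * F.L : ℕ) : ℝ)) ^ (Ts - n) with hA
  set I : Set ℝ := Set.Ioo (-1 : ℝ) 2 ∩ Set.uIcc x y with hI
  set g : ℝ → ℝ := fun s => dist1 (GaugeField.plaqHol (descendTo F ℰp n Ts hnT (c s)) p) with hg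
  have hA0 : 0 ≤ A := by rw [hA]; positivity
  have hK0 : 0 ≤ K := le_trans (Finset.sum_nonneg fun e _ => hk0 e) hK
  have hke : ∀ e, k e ≤ K := fun e =>
    le_trans (Finset.single_le_sum (fun e _ => hk0 e) (Finset.mem_univ e)) hK
  have hst : 0 ≤ stokesConst (F.P Ts) := stokesConst_nonneg _
  have hC0 : 0 ≤ 4 * A * (Real.sqrt 3 * K) := by positivity
  -- (i) base in the open interior, partner within `δ`: one application of §2
  have hbase : ∀ r ∈ I, r ∈ Set.uIoo x y → ∀ s ∈ I, |r - s| ≤ δ → |g s - g r| ≤ 4 * A * (Real.sqrt 3 * K) * |r - s| := by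
    intro r hr hro s hs hrs
    have hρ : 0 ≤ Real.sqrt 3 * K * |r - s| := by positivity
    have hcl : ∀ e : PBond (F.P Ts) 0,
        ‖((c s e : Matrix.specialUnitaryGroup (Fin 2) ℂ) : Matrix (Fin 2) (Fin 2) ℂ) - (c r e : Matrix (Fin 2) (Fin 2) ℂ)‖ ≤
          Real.sqrt 3 * K * |r - s| := by
      refine norm_coe_sub_le_of_incr (c r) (c s) (fun e => ?_)
      obtain ⟨w, hw, hwle⟩ := hincr r hr s hs hrs e
      refine ⟨w, hw, ?_⟩
      calc Real.sqrt 3 * ‖w‖ ≤ Real.sqrt 3 * (k e * |r - s|) :=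
            mul_le_mul_of_nonneg_left hwle (Real.sqrt_nonneg _)
        _ ≤ Real.sqrt 3 * (K * |r - s|) :=
            mul_le_mul_of_nonneg_left (mul_le_mul_of_nonneg_right (hke e) (abs_nonneg _)) (Real.sqrt_nonneg _)
        _ = Real.sqrt 3 * K * |r - s| := by ring
    have h24' : stokesConst (F.P Ts) * (24 / 25 * θmax + 4 * (A * (Real.sqrt 3 * K * |r - s|))) ≤ 1 / 24 := by
      have hmono : A * (Real.sqrt 3 * K * |r - s|) ≤ A * (Real.sqrt 3 * K * δ) :=
        mul_le_mul_of_nonneg_left (mul_le_mul_of_nonneg_left hrs (by positivity)) hA0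
      have hsum : 24 / 25 * θmax + 4 * (A * (Real.sqrt 3 * K * |r - s|)) ≤ 24 / 25 * θmax + 4 * (A * (Real.sqrt 3 * K * δ)) := by
        linarith
      exact (mul_le_mul_of_nonneg_left hsum hst).trans h24
    have h := abs_dist1_descendTo_sub_le_of_multiwindow F hjn hnT (c r) (c s) hθmax0 hρ (hMW r hro) hθle hcl h24' p
    calc |g s - g r| ≤ 4 * (A * (Real.sqrt 3 * K * |r - s|)) := h
      _ = 4 * A * (Real.sqrt 3 * K) * |r - s| := by ring
  -- (ii) any pair of `I` at distance `≤ δ`: base at the midpoint, which is in the open interior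
  have hIconv : Convex ℝ I := (convex_Ioo _ _).inter (convex_uIcc x y)
  have hloc : ∀ s ∈ I, ∀ s' ∈ I, |s - s'| ≤ δ → |g s - g s'| ≤ (Real.toNNReal (4 * A * (Real.sqrt 3 * K)) : ℝ) * |s - s'| := by
    intro s hs s' hs' hss'
    rw [Real.coe_toNNReal _ hC0]
    rcases eq_or_ne s s' with h | h
    · subst h; simp
    -- the midpoint
    set r : ℝ := (s + s') / 2 with hr
    have hrI : r ∈ I := by
      have := hIconv hs hs' (a := 1/2) (b := 1/2) (by norm_num) (by norm_num) (by norm_num)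
      simpa [hr, smul_eq_mul, div_eq_inv_mul, mul_add, add_comm, add_div] using this
    have hro : r ∈ Set.uIoo x y := by
      have h1 : x ⊓ y ≤ s := hs.2.1
      have h2 : s ≤ x ⊔ y := hs.2.2
      have h3 : x ⊓ y ≤ s' := hs'.2.1
      have h4 : s' ≤ x ⊔ y := hs'.2.2
      show r ∈ Set.Ioo (x ⊓ y) (x ⊔ y)
      rw [Set.mem_Ioo, hr]
      rcases lt_or_gt_of_ne h with hlt | hlt <;> constructor <;> linarith
    have hrs : |r - s| ≤ δ := by
      rw [hr, show (s + s') / 2 - s = (s' - s) / 2 by ring, abs_div, abs_two, abs_sub_comm]; linarith [abs_nonneg (s - s')]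
    have hrs' : |r - s'| ≤ δ := by
      rw [hr, show (s + s') / 2 - s' = (s - s') / 2 by ring, abs_div, abs_two]; linarith [abs_nonneg (s - s')]
    have h1 := hbase r hrI hro s hs hrs
    have h2 := hbase r hrI hro s' hs' hrs'
    have e1 : |r - s| = |s - s'| / 2 := by
      rw [hr, show (s + s') / 2 - s = (s' - s) / 2 by ring, abs_div, abs_two, abs_sub_comm]
    have e2 : |r - s'| = |s - s'| / 2 := by
      rw [hr, show (s + s') / 2 - s' = (s - s') / 2 by ring, abs_div, abs_two]
    calc |g s - g s'| = |(g s - g r) - (g s' - g r)| := by ring_nf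
      _ ≤ |g s - g r| + |g s' - g r| := abs_sub _ _
      _ ≤ 4 * A * (Real.sqrt 3 * K) * |r - s| + 4 * A * (Real.sqrt 3 * K) * |r - s'| := add_le_add h1 h2
      _ = 4 * A * (Real.sqrt 3 * K) * |s - s'| := by rw [e1, e2]; ring
  -- (iii) local to global on the convex set `I` (diameter `≤ 3`)
  obtain ⟨N, hN⟩ := exists_nat_gt (3 / δ)
  have hNpos : 0 < N := by
    have : (0 : ℝ) < N := lt_trans (by positivity) hN
    exact_mod_cast this
  refine lipschitzOnWith_of_local hIconv δ N hNpos (fun a ha b hb => ?_) hloc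
  have hab : |a - b| ≤ 3 := by
    have ha1 := ha.1; have hb1 := hb.1
    rw [Set.mem_Ioo] at ha1 hb1
    rw [abs_le]; constructor <;> linarith
  have : (3 : ℝ) ≤ N * δ := by
    have := (div_lt_iff₀ hδ).1 hN
    linarith
  linarith

/-! ## §4 The organ readings: (L44b)'s (Φ-disp-Lip∣MW) letters from its (Φ-bond-incr-loc∣MW) letters -/

/-- ★★★ **(Φ-disp-Lip∣MW) ALONG NEAR RELATIONAL PATHS ⟸ (Φ-bond-incr-loc∣MW)** — the `hPdisp` binder of ✓`weightLip_of_beta_of_goodSetLetters` CHARACTER-EXACT, level-uniform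
modulus `D := toNNReal (4·(30ℓ)^{Ts−(j+1)}·(√3·K))`, from its `hPincr` binder CHARACTER-EXACT + `θ_{n′} ≤ θmax` on `(j, Ts]` + ONE smallness row. [folklore] -/
theorem pdispLip_of_incr (γ b₀ p₀ : ℝ) (j Ts : ℕ)
    {Z : Type} (Φ : GaugeField (F.P j) 0 ↥(Matrix.specialUnitaryGroup (Fin 2) ℂ) × Z → GaugeField (F.P Ts) 0 ↥(Matrix.specialUnitaryGroup (Fin 2) ℂ))
    (rc : ℝ) {θmax δ K : ℝ} (hθmax0 : 0 ≤ θmax) (hθle : ∀ n', j + 1 ≤ n' → n' ≤ Ts → θBal F.L γ b₀ p₀ n' ≤ θmax) (hδ : 0 < δ)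
    (k : PBond (F.P Ts) 0 → ℝ) (hk0 : ∀ e, 0 ≤ k e) (hK : ∑ e, k e ≤ K)
    (h24 : stokesConst (F.P Ts) * (24 / 25 * θmax + 4 * ((30 * (((3 + 2) * F.L : ℕ) : ℝ)) ^ (Ts - (j + 1)) * (Real.sqrt 3 * K * δ))) ≤ 1 / 24)
    (hPincr : ∀ (B' : PBond (F.P j) 0) (m' : Fin 3 → ℝ) (U₂ : GaugeField (F.P j) 0 ↥(Matrix.specialUnitaryGroup (Fin 2) ℂ))
      (X : ℝ → GaugeField (F.P j) 0 ↥(Matrix.specialUnitaryGroup (Fin 2) ℂ)), ‖m'‖ ≤ rc * (θBal F.L γ b₀ p₀ j / 4) → PlaqSmall (θBal F.L γ b₀ p₀ j / 4) U₂ →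
      (∀ s e, e ≠ B' → X s e = U₂ e) → (∀ s, X s B' = U₂ B' * expPt (s • m')) → ∀ (z : Z), ∀ x ∈ Set.Ioo (-1 : ℝ) 2, ∀ y ∈ Set.Ioo (-1 : ℝ) 2,
        (∀ r ∈ Set.uIoo x y, ∀ (n : ℕ) (hjn : j + 1 ≤ n) (hnK : n ≤ Ts), PlaqSmall (24 / 25 * θBal F.L γ b₀ p₀ n) (descendTo F ℰp n Ts hnK (Φ (X r, z)))) →
        ∀ s ∈ Set.Ioo (-1 : ℝ) 2 ∩ Set.uIcc x y, ∀ s' ∈ Set.Ioo (-1 : ℝ) 2 ∩ Set.uIcc x y, |s - s'| ≤ δ →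
          ∀ e, ∃ w : Fin 3 → ℝ, Φ (X s', z) e = Φ (X s, z) e * expPt w ∧ ‖w‖ ≤ k e * |s - s'|) :
    ∀ (B' : PBond (F.P j) 0) (m' : Fin 3 → ℝ) (U₂ : GaugeField (F.P j) 0 ↥(Matrix.specialUnitaryGroup (Fin 2) ℂ))
      (X : ℝ → GaugeField (F.P j) 0 ↥(Matrix.specialUnitaryGroup (Fin 2) ℂ)), ‖m'‖ ≤ rc * (θBal F.L γ b₀ p₀ j / 4) → PlaqSmall (θBal F.L γ b₀ p₀ j / 4) U₂ →
      (∀ s e, e ≠ B' → X s e = U₂ e) → (∀ s, X s B' = U₂ B' * expPt (s • m')) → ∀ (z : Z), ∀ x ∈ Set.Ioo (-1 : ℝ) 2, ∀ y ∈ Set.Ioo (-1 : ℝ) 2,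
        (∀ r ∈ Set.uIoo x y, ∀ (n : ℕ) (hjn : j + 1 ≤ n) (hnK : n ≤ Ts), PlaqSmall (24 / 25 * θBal F.L γ b₀ p₀ n) (descendTo F ℰp n Ts hnK (Φ (X r, z)))) →
        ∀ (n : ℕ) (hjn : j + 1 ≤ n) (hnT : n ≤ Ts) (p : Plaq (F.P n) 0),
          LipschitzOnWith (Real.toNNReal (4 * (30 * (((3 + 2) * F.L : ℕ) : ℝ)) ^ (Ts - (j + 1)) * (Real.sqrt 3 * K)))
            (fun s => dist1 (GaugeField.plaqHol (descendTo F ℰp n Ts hnT (Φ (X s, z))) p)) (Set.Ioo (-1 : ℝ) 2 ∩ Set.uIcc x y) := by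
  intro B' m' U₂ X hm' hU₂ hoff hon z x hx y hy hMW n hjn hnT p
  have hK0 : 0 ≤ K := le_trans (Finset.sum_nonneg fun e _ => hk0 e) hK
  have hbase : (1 : ℝ) ≤ (30 * (((3 + 2) * F.L : ℕ) : ℝ)) := by
    have := F.hL.2
    have h5 : (1 : ℝ) ≤ (((3 + 2) * F.L : ℕ) : ℝ) := by exact_mod_cast (show 1 ≤ (3 + 2) * F.L by omega)
    linarith
  have hAle : (30 * (((3 + 2) * F.L : ℕ) : ℝ)) ^ (Ts - n) ≤ (30 * (((3 + 2) * F.L : ℕ) : ℝ)) ^ (Ts - (j + 1)) :=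
    pow_le_pow_right₀ hbase (by omega)
  have h24n : stokesConst (F.P Ts) * (24 / 25 * θmax + 4 * ((30 * (((3 + 2) * F.L : ℕ) : ℝ)) ^ (Ts - n) * (Real.sqrt 3 * K * δ))) ≤ 1 / 24 := by
    have hmono : (30 * (((3 + 2) * F.L : ℕ) : ℝ)) ^ (Ts - n) * (Real.sqrt 3 * K * δ) ≤
        (30 * (((3 + 2) * F.L : ℕ) : ℝ)) ^ (Ts - (j + 1)) * (Real.sqrt 3 * K * δ) :=
      mul_le_mul_of_nonneg_right hAle (by positivity)
    have hsum : 24 / 25 * θmax + 4 * ((30 * (((3 + 2) * F.L : ℕ) : ℝ)) ^ (Ts - n) * (Real.sqrt 3 * K * δ)) ≤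
        24 / 25 * θmax + 4 * ((30 * (((3 + 2) * F.L : ℕ) : ℝ)) ^ (Ts - (j + 1)) * (Real.sqrt 3 * K * δ)) := by linarith
    exact (mul_le_mul_of_nonneg_left hsum (stokesConst_nonneg _)).trans h24
  have hL := lipschitzOnWith_dist1_descendTo_of_incr F hjn hnT (fun s => Φ (X s, z)) hMW hθmax0 hθle hδ k hk0 hK
    (hPincr B' m' U₂ X hm' hU₂ hoff hon z x hx y hy hMW) h24n p
  refine hL.weaken ?_
  exact Real.toNNReal_le_toNNReal (mul_le_mul_of_nonneg_right (mul_le_mul_of_nonneg_left hAle (by norm_num)) (by positivity))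

/-- ★★★ **(Φ-disp-Lip∣MW) ALONG THE `s`-EDGES OF NEAR RELATIONAL SQUARES ⟸ (Φ-bond-incr-loc∣MW)** — the `hSdisp` binder of ✓`weightLip_of_beta_of_goodSetLetters`
CHARACTER-EXACT from its `hSincr` binder CHARACTER-EXACT, same modulus and rows. [folklore] -/
theorem sdispLip_of_incr (γ b₀ p₀ : ℝ) (j Ts : ℕ)
    {Z : Type} (Φ : GaugeField (F.P j) 0 ↥(Matrix.specialUnitaryGroup (Fin 2) ℂ) × Z → GaugeField (F.P Ts) 0 ↥(Matrix.specialUnitaryGroup (Fin 2) ℂ))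
    (rc : ℝ) {θmax δ K : ℝ} (hθmax0 : 0 ≤ θmax) (hθle : ∀ n', j + 1 ≤ n' → n' ≤ Ts → θBal F.L γ b₀ p₀ n' ≤ θmax) (hδ : 0 < δ)
    (k : PBond (F.P Ts) 0 → ℝ) (hk0 : ∀ e, 0 ≤ k e) (hK : ∑ e, k e ≤ K)
    (h24 : stokesConst (F.P Ts) * (24 / 25 * θmax + 4 * ((30 * (((3 + 2) * F.L : ℕ) : ℝ)) ^ (Ts - (j + 1)) * (Real.sqrt 3 * K * δ))) ≤ 1 / 24)
    (hSincr : ∀ (B B' : PBond (F.P j) 0) (m m' : Fin 3 → ℝ) (V00 : GaugeField (F.P j) 0 ↥(Matrix.specialUnitaryGroup (Fin 2) ℂ))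
      (Y : ℝ → GaugeField (F.P j) 0 ↥(Matrix.specialUnitaryGroup (Fin 2) ℂ)) (X : ℝ → ℝ → GaugeField (F.P j) 0 ↥(Matrix.specialUnitaryGroup (Fin 2) ℂ)),
      ‖m‖ ≤ rc * (θBal F.L γ b₀ p₀ j / 4) → ‖m'‖ ≤ rc * (θBal F.L γ b₀ p₀ j / 4) → PlaqSmall (θBal F.L γ b₀ p₀ j / 4) V00 →
      (∀ s e, e ≠ B → Y s e = V00 e) → (∀ s, Y s B = V00 B * expPt (s • m)) → (∀ s s' e, e ≠ B' → X s s' e = Y s e) → (∀ s s', X s s' B' = Y s B' * expPt (s' • m')) →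
      ∀ s' ∈ Set.Icc (0:ℝ) 1, ∀ (z : Z), ∀ x ∈ Set.Ioo (-1 : ℝ) 2, ∀ y ∈ Set.Ioo (-1 : ℝ) 2,
        (∀ r ∈ Set.uIoo x y, ∀ (n : ℕ) (hjn : j + 1 ≤ n) (hnK : n ≤ Ts), PlaqSmall (24 / 25 * θBal F.L γ b₀ p₀ n) (descendTo F ℰp n Ts hnK (Φ (X r s', z)))) →
        ∀ s ∈ Set.Ioo (-1 : ℝ) 2 ∩ Set.uIcc x y, ∀ s'' ∈ Set.Ioo (-1 : ℝ) 2 ∩ Set.uIcc x y, |s - s''| ≤ δ →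
          ∀ e, ∃ w : Fin 3 → ℝ, Φ (X s'' s', z) e = Φ (X s s', z) e * expPt w ∧ ‖w‖ ≤ k e * |s - s''|) :
    ∀ (B B' : PBond (F.P j) 0) (m m' : Fin 3 → ℝ) (V00 : GaugeField (F.P j) 0 ↥(Matrix.specialUnitaryGroup (Fin 2) ℂ))
      (Y : ℝ → GaugeField (F.P j) 0 ↥(Matrix.specialUnitaryGroup (Fin 2) ℂ)) (X : ℝ → ℝ → GaugeField (F.P j) 0 ↥(Matrix.specialUnitaryGroup (Fin 2) ℂ)),
      ‖m‖ ≤ rc * (θBal F.L γ b₀ p₀ j / 4) → ‖m'‖ ≤ rc * (θBal F.L γ b₀ p₀ j / 4) → PlaqSmall (θBal F.L γ b₀ p₀ j / 4) V00 →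
      (∀ s e, e ≠ B → Y s e = V00 e) → (∀ s, Y s B = V00 B * expPt (s • m)) → (∀ s s' e, e ≠ B' → X s s' e = Y s e) → (∀ s s', X s s' B' = Y s B' * expPt (s' • m')) →
      ∀ s' ∈ Set.Icc (0:ℝ) 1, ∀ (z : Z), ∀ x ∈ Set.Ioo (-1 : ℝ) 2, ∀ y ∈ Set.Ioo (-1 : ℝ) 2,
        (∀ r ∈ Set.uIoo x y, ∀ (n : ℕ) (hjn : j + 1 ≤ n) (hnK : n ≤ Ts), PlaqSmall (24 / 25 * θBal F.L γ b₀ p₀ n) (descendTo F ℰp n Ts hnK (Φ (X r s', z)))) →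
        ∀ (n : ℕ) (hjn : j + 1 ≤ n) (hnT : n ≤ Ts) (p : Plaq (F.P n) 0),
          LipschitzOnWith (Real.toNNReal (4 * (30 * (((3 + 2) * F.L : ℕ) : ℝ)) ^ (Ts - (j + 1)) * (Real.sqrt 3 * K)))
            (fun s => dist1 (GaugeField.plaqHol (descendTo F ℰp n Ts hnT (Φ (X s s', z))) p)) (Set.Ioo (-1 : ℝ) 2 ∩ Set.uIcc x y) := by
  intro B B' m m' V00 Y X hm hm' hV00 hYoff hYon hXoff hXon s' hs' z x hx y hy hMW n hjn hnT p
  have hK0 : 0 ≤ K := le_trans (Finset.sum_nonneg fun e _ => hk0 e) hK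
  have hbase : (1 : ℝ) ≤ (30 * (((3 + 2) * F.L : ℕ) : ℝ)) := by
    have := F.hL.2
    have h5 : (1 : ℝ) ≤ (((3 + 2) * F.L : ℕ) : ℝ) := by exact_mod_cast (show 1 ≤ (3 + 2) * F.L by omega)
    linarith
  have hAle : (30 * (((3 + 2) * F.L : ℕ) : ℝ)) ^ (Ts - n) ≤ (30 * (((3 + 2) * F.L : ℕ) : ℝ)) ^ (Ts - (j + 1)) :=
    pow_le_pow_right₀ hbase (by omega)
  have h24n : stokesConst (F.P Ts) * (24 / 25 * θmax + 4 * ((30 * (((3 + 2) * F.L : ℕ) : ℝ)) ^ (Ts - n) * (Real.sqrt 3 * K * δ))) ≤ 1 / 24 := by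
    have hmono : (30 * (((3 + 2) * F.L : ℕ) : ℝ)) ^ (Ts - n) * (Real.sqrt 3 * K * δ) ≤
        (30 * (((3 + 2) * F.L : ℕ) : ℝ)) ^ (Ts - (j + 1)) * (Real.sqrt 3 * K * δ) :=
      mul_le_mul_of_nonneg_right hAle (by positivity)
    have hsum : 24 / 25 * θmax + 4 * ((30 * (((3 + 2) * F.L : ℕ) : ℝ)) ^ (Ts - n) * (Real.sqrt 3 * K * δ)) ≤
        24 / 25 * θmax + 4 * ((30 * (((3 + 2) * F.L : ℕ) : ℝ)) ^ (Ts - (j + 1)) * (Real.sqrt 3 * K * δ)) := by linarith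
    exact (mul_le_mul_of_nonneg_left hsum (stokesConst_nonneg _)).trans h24
  have hL := lipschitzOnWith_dist1_descendTo_of_incr F hjn hnT (fun s => Φ (X s s', z)) hMW hθmax0 hθle hδ k hk0 hK
    (hSincr B B' m m' V00 Y X hm hm' hV00 hYoff hYon hXoff hXon s' hs' z x hx y hy hMW) h24n p
  refine hL.weaken ?_
  exact Real.toNNReal_le_toNNReal (mul_le_mul_of_nonneg_right (mul_le_mul_of_nonneg_left hAle (by norm_num)) (by positivity))

end Summit.QuantumFields.YangMills.Theorems.OrganTangentMultiLevelDispLipOfIncr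

end
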